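import Summits.QuantumFields.QCD.Theses.RenormalisedVafaWitten
import Summits.QuantumFields.QCD.Theorems.RobustYangMillsHandover.Negative.SchemeAsymptotics
import HarnessLib

/-!
# Route `RenormalisedVafaWitten` (QCD): the support item `MassRenormalisationDiverges` (stmt-QuantumFields-8698)

For `N_f ≤ 16` and every regularisation `reg` with leading-log mass scaling (`HasMassScaling`:
`Z_m(k) / (log a_k⁻²)^{γ₀/(2β₀)} → c > 0`), the mass renormalisation factor diverges, `Z_m(k) → ∞`.  This is, by name, the
tree theorem `RobustYangMillsHandover.Negative.tendsto_Zm_atTop` (`Theorems/RobustYangMillsHandover/Negative/SchemeAsymptotics.lean`: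
the exponent `γ₀/(2β₀) = 12/(33 − 2N_f)` is positive for `N_f ≤ 16`, `a_k → 0⁺` gives `log a_k⁻² → ∞`, and a positive limit times
`∞` is `∞`).  Nothing is asserted about QCD; no summit, leg or crux statement is proved (width seat ym-t4-w17 g0, free hands).
-/

set_option autoImplicit false

namespace Summit.QuantumFields.QCD.Theorems

/-- **Item stmt-QuantumFields-8698 `RenormalisedVafaWitten.MassRenormalisationDiverges` holds**, by the tree theorem
`RobustYangMillsHandover.Negative.tendsto_Zm_atTop`. [folklore] -/
theorem renormalisedVafaWitten_massRenormalisationDiverges_proof :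
    Summit.QuantumFields.QCD.Theses.RenormalisedVafaWitten.MassRenormalisationDiverges := by
  unfold Summit.QuantumFields.QCD.Theses.RenormalisedVafaWitten.MassRenormalisationDiverges
  intro Nf hNf reg h
  exact RobustYangMillsHandover.Negative.tendsto_Zm_atTop hNf reg h

end Summit.QuantumFields.QCD.Theorems
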